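import Summits.Parity.BatemanHorn.Theses.AlmostPrimeZeros

/-!
# Sketch — crux-ideate k1 on `DiscMajorantLog` (stmt-Parity-17114): first lemmas of the two cards

Scratch only (planner).  Everything here is a *statement* that must elaborate; proofs are `sorry`.
-/

noncomputable section

namespace Summit.Parity.BatemanHorn.Cruxes.DiscMajorantLog.IdeasK1

open scoped BigOperators
open Finset
open Summit.Parity.BatemanHorn.Theses.AlmostPrimeZeros
open Literature.NumberTheory.Sieve

/-- The capped statistic of the crux, `s(m) = Σ_{p^v ∥ m} min(v,2)`. -/
def sCap (m : ℕ) : ℕ := m.factorization.sum fun _ v => min v 2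

/-- The system statistic `s_f(n) = Σ_i s((f_i(n))⁺)` exactly as in the crux signature. -/
def sSys (k : ℕ) (f : Fin k → Polynomial ℤ) (n : ℕ) : ℕ :=
  ∑ i, sCap (((f i).eval (n : ℤ)).toNat)

/-! ## Card A (`visible-divisor-certificates`): first lemmas -/

/-- GREEDY VISIBLE DIVISOR (combinatorial core of every level-`X` certificate): a `y`-friable
integer `M > Z` has a divisor `d ≤ Z` with `Z < d * y`.  (Take `d` = the largest divisor `≤ Z`;
if `d * y ≤ Z`, some prime `p ≤ y` divides `M / d` and `d * p ≤ Z` contradicts maximality.) -/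
theorem greedy_visible_divisor :
    ∀ (M y Z : ℕ), 2 ≤ y → 1 ≤ Z → Z < M → (∀ p ∈ M.primeFactors, p ≤ y) →
      ∃ d ∈ M.divisors, d ≤ Z ∧ Z < d * y := by
  sorry

/-- The REAL-AXIS part of the crux (`z = t ∈ [1, 1 + 3 log log x]`), verbatim specialisation of
`DiscMajorantLog` to real `z` (there `(z:ℂ).re - 1 = t - 1`, `‖z-1‖ = t-1`). -/
def RealAxisDiscMajorant : Prop :=
  ∀ (k : ℕ) (f : Fin k → Polynomial ℤ), IsBatemanHornSystem f →
    ∃ A C : ℝ, ∃ x₀ : ℕ, ∀ x : ℕ, x₀ ≤ x → ∀ t : ℝ, 1 ≤ t → t - 1 ≤ 3 * Real.log (Real.log (x : ℝ)) →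
      (∑ n ∈ Finset.range (x + 1), t ^ sSys k f n) ≤
        A * (x : ℝ) * (Real.log (x : ℝ)) ^ ((k : ℝ) * (t - 1)) *
          Real.exp (C * (t - 1) * Real.log ((t - 1) + 2))

/-- TRANSFER TARGET of Card A: Poisson-SHARP upper tails for `s_f` along the system (factorial precision,
with the `(log x)^{-k}` normalisation), for all `m` up to the Legendre-dual range `3k(log log x)² + k log log x`
of the real segment, with the crux's slack `e^{C t log(t+2)}`, `t = m/(kL)`. -/
def PoissonTailAlongSystem : Prop :=
  ∀ (k : ℕ) (f : Fin k → Polynomial ℤ), IsBatemanHornSystem f →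
    ∃ A C : ℝ, ∃ x₀ : ℕ, ∀ x : ℕ, x₀ ≤ x → ∀ m : ℕ,
      (k : ℝ) * Real.log (Real.log (x : ℝ)) ≤ m →
      (m : ℝ) ≤ 3 * k * Real.log (Real.log (x : ℝ)) ^ 2 + k * Real.log (Real.log (x : ℝ)) →
        (((Finset.range (x + 1)).filter fun n => m ≤ sSys k f n).card : ℝ) ≤
          A * (x : ℝ) * Real.exp (-(k * Real.log (Real.log (x : ℝ))))
            * ((k : ℝ) * Real.log (Real.log (x : ℝ))) ^ m / (m.factorial : ℝ)
            * Real.exp (C * (m / (k * Real.log (Real.log (x : ℝ)))) *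
                Real.log (m / (k * Real.log (Real.log (x : ℝ))) + 2))

/-- Card A, duality: Poisson-sharp tails give the real-axis majorant (Abel/ratio test on
`Σ_n t^{s_f(n)} = Σ_m t^m #{s_f = m}`; the bulk `m ≤ kL` is the trivial bound
`≤ (x+1) t^{kL} = (x+1)(log x)^{k log t} ≤ (x+1)(log x)^{k(t-1)}`). -/
theorem realAxisDiscMajorant_of_poissonTail :
    PoissonTailAlongSystem → RealAxisDiscMajorant := by
  sorry

/-- Root count of `F = ∏ f_i` modulo `d` (all `d`, not only primes). -/
def rhoF (k : ℕ) (f : Fin k → Polynomial ℤ) (d : ℕ) : ℕ :=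
  ((Finset.range d).filter fun n : ℕ => (d : ℤ) ∣ ∏ i, (f i).eval (n : ℤ)).card

/-- Largest prime factor (`1` for `d ≤ 1`). -/
def maxPrimeFac (d : ℕ) : ℕ := d.primeFactors.sup id

/-- THE VISIBLE-DIVISOR CERTIFICATE (♠), every system, level `x` only: with `D = Σ natDegree f_i`,
`Σ_{n≤x} t^{s_f(n)} ≤ 2 t² x Σ_{2 ≤ d ≤ x} (ρ_F(d)/d) t^{s(d)} t^{2(kD-1) log x / log P⁺(d)} + (small-n junk)`.
(Initial segment `d₁(n)` of the factorisation of `F(n)` of product `≤ x`; every remaining prime is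
`≥ P⁺(d₁)` and the remaining log-mass is `≤ (kD-1) log x + log P⁺`, so
`s_f(n) ≤ s(d₁) + 2(kD-1) log x/log P⁺(d₁) + 4`; then `#{n ≤ x : d ∣ F(n)} ≤ ρ_F(d)(x/d + 1)`.)
Stated for `x ≥ x₀(f)` and `t ≥ 1`; the `n` with `F(n)` having no prime factor `≤ x` contribute `≤ t^{2kD}` each
and are absorbed in the first summand `d = 1`-free form by the constant `A₀`. -/
theorem visible_divisor_certificate :
    ∀ (k : ℕ) (f : Fin k → Polynomial ℤ), IsBatemanHornSystem f →
      ∃ A₀ : ℝ, ∃ x₀ : ℕ, ∀ x : ℕ, x₀ ≤ x → ∀ t : ℝ, 1 ≤ t →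
        (∑ n ∈ Finset.range (x + 1), t ^ sSys k f n) ≤
          A₀ * t ^ (2 * ∑ i, (f i).natDegree) * (x : ℝ) *
            (1 + ∑ d ∈ Finset.Icc 2 x, (rhoF k f d : ℝ) / d * t ^ sCap d *
              t ^ (2 * ((∑ i, (f i).natDegree : ℝ) - 1) * Real.log x / Real.log (maxPrimeFac d))) := by
  sorry

/-- The FIXED-INTERVAL real segment (all systems): what (♠) + κ-dimensional friable harmonic sums give
(re-proving Nair–Tenenbaum's bound with explicit constants); `T` fixed, constants depend on `(f, T)`. -/
def RealAxisFixedInterval : Prop :=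
  ∀ (k : ℕ) (f : Fin k → Polynomial ℤ), IsBatemanHornSystem f → ∀ T : ℝ, 1 ≤ T →
    ∃ A : ℝ, ∃ x₀ : ℕ, ∀ x : ℕ, x₀ ≤ x → ∀ t : ℝ, 1 ≤ t → t ≤ T →
      (∑ n ∈ Finset.range (x + 1), t ^ sSys k f n) ≤ A * (x : ℝ) * (Real.log (x : ℝ)) ^ ((k : ℝ) * (t - 1))

theorem realAxisFixedInterval_of_certificate : RealAxisFixedInterval := by
  sorry

/-! ## Card B (`ewens-shift-switching`): first lemmas -/

/-- The cubefree multiplicative weight `h_z` with `z^{s(m)} = Σ_{d ∣ m} h_z(d)`: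
`h_z(p) = z - 1`, `h_z(p²) = z² - z`, `h_z(p^v) = 0` for `v ≥ 3`. -/
def hz (z : ℂ) (d : ℕ) : ℂ :=
  if ∀ p ∈ d.primeFactors, d.factorization p ≤ 2 then
    ∏ p ∈ d.primeFactors, (if d.factorization p = 1 then z - 1 else z ^ 2 - z)
  else 0

/-- DIVISOR EXPANSION of the capped weight (local check: `1 + (z-1) + (z²-z)[v ≥ 2] = z^{min(v,2)}`). -/
theorem pow_sCap_eq_sum_hz :
    ∀ (m : ℕ) (z : ℂ), m ≠ 0 → z ^ sCap m = ∑ d ∈ m.divisors, hz z d := by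
  sorry

/-- HOOLEY SWITCHING for `n² + 1` (the involution `d ↔ (n²+1)/d` exchanges the beyond-level range
`d > x` with the Type-I range `e < (n²+1)/x ≤ x + 1/x`): pure re-indexing, any weight `w`. -/
theorem switching_identity :
    ∀ (x : ℕ) (w : ℕ → ℂ),
      (∑ n ∈ Finset.range (x + 1), ∑ d ∈ (n ^ 2 + 1).divisors with x < d, w d) =
        ∑ n ∈ Finset.range (x + 1), ∑ e ∈ (n ^ 2 + 1).divisors with e * x < n ^ 2 + 1,
          w ((n ^ 2 + 1) / e) := by
  sorry

/-- The SHIFT `z ↦ z - 1` made visible (squarefree values; the general cubefree bookkeeping is in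
the card): on the beyond-level side the weight is `h_z((n²+1)/e) = (z-1)^{ω(n²+1) - ω(e)}`, i.e.
`S_x(z) = [Type-I, level x] + Σ_{e ≤ x} (z-1)^{-ω(e)} · S^{AP}_{x}(z-1; e)`, the arithmetic shadow of
`1/Γ(z-1) = (z-1)/Γ(z)` in the LSD heuristic `S_x(z) ≈ x λ_f(z) (log x)^{z-1} Γ(z)^{-1}`. -/
theorem hz_of_squarefree_cofactor :
    ∀ (z : ℂ) (M e : ℕ), Squarefree M → e ∣ M → z ≠ 1 →
      hz z (M / e) = (z - 1) ^ M.primeFactors.card * ((z - 1) ^ e.primeFactors.card)⁻¹ := by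
  sorry

end Summit.Parity.BatemanHorn.Cruxes.DiscMajorantLog.IdeasK1
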